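import Literature.MathematicalPhysics.QuantumLattice.TorusSectorGibbsMixtureSymmetry
import Literature.MathematicalPhysics.QuantumLattice.TorusGibbsTwoSectorEnergyEntropyBalance
import HarnessLib

/-!
# `D₄`-invariance of torus limits of the canonical states of a general spin sector `(a_L, b_L)` — the
# point-group rows of the COMPANION states of the two-sector energy–entropy balance

Topic `Literature/MathematicalPhysics/QuantumLattice`; complement of `TorusSectorGibbsMixtureSymmetry.lean`
(§1–§2 there: the canonical Gibbs mixtures of the `t–t'` torus on the sector `(rectN n L, S^z = 0)` are
invariant under the point-group unitaries `D_γ` and the translations, and every torus limit of them is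
`D₄`-invariant) for the canonical eigen-mixtures of an ARBITRARY spin sector `(N↑, N↓) = (a, b)` in any
presentation `(m, p, ψ, e)` (as in `InfVolFermionStateTorusLimitSpinSectorGibbsRows.lean`). These are the
COMPANION states `ω'` of the two-sector (charged) rows (`(k_L ∓ 1, k_L)`, `(k_L − 1, k_L − 1)`, …), whose
equation-of-motion, gauge-invariant EEB and density rows are typed (`…SpinSectorGibbsRows`,
`…SpinSectorDensity`) but whose point-group rows were not:

* §1 `sum_canonicalWeight_spinSector_mul_expect_mulVec_eq` (generic unitary invariance transported to the
  presentation), `…_fockD4_mulVec_eq` (`D_γ` commutes with `H_L` and preserves every joint sector),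
  `…_fockTranslate_mulVec_eq`;
* §2 `sum_canonicalWeight_spinSector_mul_torusAvgExpectAt_d4Emb` — the weighted translation average of the
  `D₄`-image of a local observable equals that of the observable (the proof of
  `sum_sectorGibbsWeightTT'_mul_torusAvgExpectAt_d4Emb` verbatim in the general presentation);
* §3 **`IsTorusLimitOfMixture.isD4Invariant_of_spinSectorGibbs`**: every torus limit of the canonical
  eigen-mixtures of the spin sectors `(a_L, b_L)` of `hubbardTorusTT' L t t' U` is `D₄`-invariant (any
  `β, t, t', U`, any sector sequences — no nonemptiness needed), and kills every affine-`D₄` defect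
  (`…expect_d4Defect_eq_zero_of_spinSectorGibbs`) — so point-group-REDUCED certificates for the companion
  classes are read without orbit averaging, exactly as for the object of record. (Spin-flip symmetry does
  NOT hold for `a ≠ b` and is not claimed.)

Everything is PROVED; no definition, no named fact, no instance.

## Mathlib / tree search

REUSED: `sum_canonicalWeight_mul_expect_mulVec_eq` (`SectorGibbsMixtureInvariance`),
`fockD4_val_mul_val_conjTranspose_mul`, `sum_sectorGibbsWeightTT'_mul_torusAvgExpectAt_d4Emb` (pattern;
`TorusSectorGibbsMixtureSymmetry`), `fockD4_mulVec_mem_szSector` (`FockRelabel`), `fockD4_val_conjTranspose`,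
`fermionEmbed_toTorusEmb_d4Emb` (`HubbardWindowCertificateD4`), `fockD4_commute_hubbardTorusTT'`,
`fockD4_val_mul_fockTranslate_val`, `mem_szSector_iff_spinConfig`, `apply_eq_zero_of_spinConfig_of_mulVec_mem`,
`hubbardTorusTT'_apply_eq_zero_of_spinConfig`, `fockTranslate_apply_eq_zero_of_spinConfig`,
`fockTranslate_conjTranspose_apply_eq_zero_of_spinConfig` (`TorusGibbsTwoSectorEnergyEntropyBalance`),
`d4Act_expect`, `IsTranslationInvariant.expect_d4Defect_eq_zero`, `IsTorusLimitOfMixture.isTranslationInvariant`.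
`lean search 'isD4Invariant_of_spinSector'`: nothing (2026-08-27).

## References

* X. Han, *Quantum many-body bootstrap*, arXiv:2006.06002 (2020), §3 (point-group constraints).
  [cite: Han2020Bootstrap, §3]
* D. J. Scalapino, Phys. Rep. 250 (1995) 329, §2 (the point group of the square lattice). [cite: Scalapino1995, §2]
* R. B. Israel, *Convexity in the Theory of Lattice Gases* (1979), §I.3 eq. (26). [cite: Israel1979, §I.3 eq. (26)]
* O. Bratteli, D. W. Robinson, *OAQSM 2* (1997), §5.2.2 Thm. 5.2.5. [cite: BratteliRobinsonII1997, Thm. 5.2.5]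
* E. H. Lieb, Phys. Rev. Lett. 62 (1989) 1201, Remark (2) (spin sectors). [cite: LiebPRL1989, Remark (2)]
-/

noncomputable section

namespace Literature.MathematicalPhysics.QuantumLattice

open Matrix Finset HubbardWave0 Literature.Probability.LatticeModels ThermodynamicLimit
open _root_.Filter
open scoped _root_.Topology ComplexOrder BigOperators

/-! ### §1 Unitary invariance of the canonical mixtures of a spin sector, in any presentation -/

section Torus

variable (L : ℕ)

/-- The point-group unitaries have no entries from a spin sector `(a, b)` to its complement (they preserve
every joint sector, `fockD4_mulVec_mem_szSector`). [cite: Scalapino1995, §2] -/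
theorem fockD4_apply_eq_zero_of_spinConfig [NeZero L] (γ : DihedralGroup 4) (a b : ℕ)
    (s s' : Finset (Orb (FermionTorus 2 L))) (hs : ¬ spinConfig a b s) (hs' : spinConfig a b s') :
    (fockD4 (L := L) γ).val s s' = 0 :=
  apply_eq_zero_of_spinConfig_of_mulVec_mem L (fun _ hv => fockD4_mulVec_mem_szSector γ hv) s s' hs hs'

/-- **Unitary invariance of the canonical mixture of a spin sector, in any presentation.** For a torus
operator `V` with `V(VᴴX) = X`, commuting with `H_L = hubbardTorusTT' L t t' U` and with `V`, `Vᴴ` having no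
entries from `spinConfig a b` to its complement, and canonical eigen-data presented as `(p, ψ)` through an
enumeration `e`: `Σ_i p_i ⟨Vψ_i, Y Vψ_i⟩ = Σ_i p_i ⟨ψ_i, Y ψ_i⟩`. [cite: Israel1979, §I.3 eq. (26)] -/
theorem sum_canonicalWeight_spinSector_mul_expect_mulVec_eq (t t' U β : ℝ) {a b : ℕ} {m : ℕ}
    {p : Fin m → ℝ} {ψ : Fin m → Fock (Orb (FermionTorus 2 L))}
    (e : Fin m ≃ Subtype (spinConfig (Λ := FermionTorus 2 L) a b))
    (hp : ∀ i, p i = canonicalWeight β (sectorEigenvalue (spinConfig a b) (hubbardTorusTT' L t t' U)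
      (hubbardTorusTT'_isHermitian L t t' U)) (e i))
    (hψ : ∀ i, ψ i = sectorEigenvector (spinConfig a b) (hubbardTorusTT' L t t' U)
      (hubbardTorusTT'_isHermitian L t t' U) (e i))
    {V : Matrix (Finset (Orb (FermionTorus 2 L))) (Finset (Orb (FermionTorus 2 L))) ℂ}
    (hV' : ∀ X, V * (Vᴴ * X) = X) (hVA : Commute V (hubbardTorusTT' L t t' U))
    (hVp : ∀ s s', ¬ spinConfig a b s → spinConfig a b s' → V s s' = 0)
    (hVp' : ∀ s s', ¬ spinConfig a b s → spinConfig a b s' → Vᴴ s s' = 0)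
    (Y : Matrix (Finset (Orb (FermionTorus 2 L))) (Finset (Orb (FermionTorus 2 L))) ℂ) :
    ∑ i, (p i : ℂ) * expect Y (V *ᵥ ψ i) = ∑ i, (p i : ℂ) * expect Y (ψ i) := by
  have key := sum_canonicalWeight_mul_expect_mulVec_eq (spinConfig (Λ := FermionTorus 2 L) a b)
    (hubbardTorusTT'_isHermitian L t t' U)
    (fun s s' hs hs' => hubbardTorusTT'_apply_eq_zero_of_spinConfig L t t' U a b s s' hs hs') hV' hVA hVp hVp' β Y
  simp_rw [hp, hψ, expect]
  rw [Equiv.sum_comp e (fun c => (canonicalWeight β (sectorEigenvalue (spinConfig a b) (hubbardTorusTT' L t t' U)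
      (hubbardTorusTT'_isHermitian L t t' U)) c : ℂ) *
      (star (V *ᵥ sectorEigenvector (spinConfig a b) (hubbardTorusTT' L t t' U) (hubbardTorusTT'_isHermitian L t t' U) c) ⬝ᵥ
        (Y *ᵥ (V *ᵥ sectorEigenvector (spinConfig a b) (hubbardTorusTT' L t t' U)
          (hubbardTorusTT'_isHermitian L t t' U) c)))),
    Equiv.sum_comp e (fun c => (canonicalWeight β (sectorEigenvalue (spinConfig a b) (hubbardTorusTT' L t t' U)
      (hubbardTorusTT'_isHermitian L t t' U)) c : ℂ) *
      (star (sectorEigenvector (spinConfig a b) (hubbardTorusTT' L t t' U) (hubbardTorusTT'_isHermitian L t t' U) c) ⬝ᵥ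
        (Y *ᵥ sectorEigenvector (spinConfig a b) (hubbardTorusTT' L t t' U) (hubbardTorusTT'_isHermitian L t t' U) c))),
    key]

/-- **Point-group invariance of the canonical state of a spin sector**: for `γ ∈ D₄` and every torus
operator `Y`, `Σ_i p_i ⟨D_γψ_i, Y D_γψ_i⟩ = Σ_i p_i ⟨ψ_i, Y ψ_i⟩` (`D_γ` commutes with `H_L` and preserves
`(N↑, N↓)`). [cite: Scalapino1995, §2] [cite: Han2020Bootstrap, §3] -/
theorem sum_canonicalWeight_spinSector_mul_expect_fockD4_mulVec_eq [NeZero L] (t t' U β : ℝ) {a b : ℕ} {m : ℕ}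
    {p : Fin m → ℝ} {ψ : Fin m → Fock (Orb (FermionTorus 2 L))}
    (e : Fin m ≃ Subtype (spinConfig (Λ := FermionTorus 2 L) a b))
    (hp : ∀ i, p i = canonicalWeight β (sectorEigenvalue (spinConfig a b) (hubbardTorusTT' L t t' U)
      (hubbardTorusTT'_isHermitian L t t' U)) (e i))
    (hψ : ∀ i, ψ i = sectorEigenvector (spinConfig a b) (hubbardTorusTT' L t t' U)
      (hubbardTorusTT'_isHermitian L t t' U) (e i))
    (γ : DihedralGroup 4) (Y : Matrix (Finset (Orb (FermionTorus 2 L))) (Finset (Orb (FermionTorus 2 L))) ℂ) :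
    ∑ i, (p i : ℂ) * expect Y ((fockD4 (L := L) γ).val *ᵥ ψ i) = ∑ i, (p i : ℂ) * expect Y (ψ i) := by
  refine sum_canonicalWeight_spinSector_mul_expect_mulVec_eq L t t' U β e hp hψ
    (fockD4_val_mul_val_conjTranspose_mul L γ) (fockD4_commute_hubbardTorusTT' γ t t' U)
    (fockD4_apply_eq_zero_of_spinConfig L γ a b) (fun s s' hs hs' => ?_) Y
  rw [fockD4_val_conjTranspose]
  exact fockD4_apply_eq_zero_of_spinConfig L γ⁻¹ a b s s' hs hs'

/-- **Translation invariance of the canonical state of a spin sector** (the same for `U_v`).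
[cite: Israel1979, §I.3 eq. (26)] [cite: BratteliRobinsonII1997, Thm. 5.2.5] -/
theorem sum_canonicalWeight_spinSector_mul_expect_fockTranslate_mulVec_eq [NeZero L] (t t' U β : ℝ) {a b : ℕ}
    {m : ℕ} {p : Fin m → ℝ} {ψ : Fin m → Fock (Orb (FermionTorus 2 L))}
    (e : Fin m ≃ Subtype (spinConfig (Λ := FermionTorus 2 L) a b))
    (hp : ∀ i, p i = canonicalWeight β (sectorEigenvalue (spinConfig a b) (hubbardTorusTT' L t t' U)
      (hubbardTorusTT'_isHermitian L t t' U)) (e i))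
    (hψ : ∀ i, ψ i = sectorEigenvector (spinConfig a b) (hubbardTorusTT' L t t' U)
      (hubbardTorusTT'_isHermitian L t t' U) (e i))
    (v : TorusSite 2 L) (Y : Matrix (Finset (Orb (FermionTorus 2 L))) (Finset (Orb (FermionTorus 2 L))) ℂ) :
    ∑ i, (p i : ℂ) * expect Y ((fockTranslate v).val *ᵥ ψ i) = ∑ i, (p i : ℂ) * expect Y (ψ i) := by
  refine sum_canonicalWeight_spinSector_mul_expect_mulVec_eq L t t' U β e hp hψ
    (fockTranslate_val_mul_val_conjTranspose_mul L v) (fockTranslate_commute_hubbardTorusTT' L v t t' U)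
    (fockTranslate_apply_eq_zero_of_spinConfig L v a b) (fun s s' hs hs' => ?_) Y
  exact fockTranslate_conjTranspose_apply_eq_zero_of_spinConfig L v a b s s' hs hs'

/-! ### §2 Translation averages of point-group images -/

/-- **The weighted translation average of the `D₄`-image of a local observable equals that of the
observable**, in the canonical mixture of any spin sector (any presentation): for `γ ∈ D₄`, a region `Λ`
with `Λ` and `γΛ` fitting into the torus, and `A ∈ 𝔄_Λ`,
`Σ_i p_i · torusAvgExpectAt L (γΛ) (Γ(d4Emb γ 0 Λ) A) ψ_i = Σ_i p_i · torusAvgExpectAt L Λ A ψ_i`.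
[cite: Han2020Bootstrap, §3] -/
theorem sum_canonicalWeight_spinSector_mul_torusAvgExpectAt_d4Emb [NeZero L] (t t' U β : ℝ) {a b : ℕ}
    {m : ℕ} {p : Fin m → ℝ} {ψ : Fin m → Fock (Orb (FermionTorus 2 L))}
    (e : Fin m ≃ Subtype (spinConfig (Λ := FermionTorus 2 L) a b))
    (hp : ∀ i, p i = canonicalWeight β (sectorEigenvalue (spinConfig a b) (hubbardTorusTT' L t t' U)
      (hubbardTorusTT'_isHermitian L t t' U)) (e i))
    (hψ : ∀ i, ψ i = sectorEigenvector (spinConfig a b) (hubbardTorusTT' L t t' U)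
      (hubbardTorusTT'_isHermitian L t t' U) (e i))
    (γ : DihedralGroup 4) {Λ : Finset (Site 2)} (hInj : Set.InjOn (Torus.proj (d := 2) L) ↑Λ)
    (hInj' : Set.InjOn (Torus.proj (d := 2) L) ↑(d4ShiftSet γ 0 Λ)) (A : FermionOp Λ) :
    ∑ i, (p i : ℂ) * torusAvgExpectAt L (d4ShiftSet γ 0 Λ) (fermionEmbed (PolySite.d4Emb γ 0 Λ) A) (ψ i) =
      ∑ i, (p i : ℂ) * torusAvgExpectAt L Λ A (ψ i) := by
  set B := fermionEmbed (PolySite.toTorusEmb L hInj) A with hB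
  set D' := (fockD4 (L := L) γ⁻¹).val with hD'
  have hproj : Torus.proj L (0 : Site 2) = 0 := by funext i; simp [Torus.proj]
  -- the pulled-back image is `D_γ B D_γᴴ`
  have hpull : fermionEmbed (PolySite.toTorusEmb L hInj') (fermionEmbed (PolySite.d4Emb γ 0 Λ) A) =
      (fockD4 (L := L) γ).val * B * (fockD4 (L := L) γ).valᴴ := by
    rw [fermionEmbed_toTorusEmb_d4Emb γ 0 hInj hInj' A, hproj, Orb.translate_zero, Equiv.Perm.one_def,
      relabel_refl, relabel_eq_fockRelabel_conj, ← fockD4_apply]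
  -- `⟨U_vψ, D B Dᴴ U_vψ⟩ = ⟨U_{γ⁻¹v} D' ψ, B U_{γ⁻¹v} D' ψ⟩`
  have hterm : ∀ (v : TorusSite 2 L) (χ : Fock (Orb (FermionTorus 2 L))),
      expect ((fockD4 (L := L) γ).val * B * (fockD4 (L := L) γ).valᴴ) ((fockTranslate v).val *ᵥ χ) =
        expect B ((fockTranslate (d4Site γ⁻¹ v)).val *ᵥ (D' *ᵥ χ)) := by
    intro v χ
    have hvec : (fockTranslate (d4Site γ⁻¹ v)).val *ᵥ (D' *ᵥ χ) =
        (fockD4 (L := L) γ).valᴴ *ᵥ ((fockTranslate v).val *ᵥ χ) := by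
      rw [mulVec_mulVec, mulVec_mulVec, hD', ← fockD4_val_mul_fockTranslate_val, fockD4_val_conjTranspose]
    rw [expect, expect, hvec, star_mulVec_dotProduct_mulVec_mulVec (fockD4 (L := L) γ).valᴴ B,
      conjTranspose_conjTranspose]
  -- reindex the translation average
  have havg : ∀ χ : Fock (Orb (FermionTorus 2 L)),
      torusAvgExpectAt L (d4ShiftSet γ 0 Λ) (fermionEmbed (PolySite.d4Emb γ 0 Λ) A) χ =
        torusAvgExpectAt L Λ A (D' *ᵥ χ) := by
    intro χ
    rw [torusAvgExpectAt_of_injOn L hInj', torusAvgExpectAt_of_injOn L hInj, hpull,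
      Finset.sum_congr rfl fun v _ => hterm v χ,
      Fintype.sum_equiv (d4SitePerm (L := L) γ⁻¹)
        (fun v => expect B ((fockTranslate (d4Site γ⁻¹ v)).val *ᵥ (D' *ᵥ χ)))
        (fun u => expect B ((fockTranslate u).val *ᵥ (D' *ᵥ χ))) (fun v => by rw [d4SitePerm_apply])]
  -- `⟨U_u φ, B U_u φ⟩ = ⟨φ, (U_uᴴ B U_u) φ⟩`
  have h1 : ∀ (u : TorusSite 2 L) (φ : Fock (Orb (FermionTorus 2 L))), expect B ((fockTranslate u).val *ᵥ φ) =
      expect ((fockTranslate u).valᴴ * B * (fockTranslate u).val) φ := fun u φ => by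
    rw [expect, expect, star_mulVec_dotProduct_mulVec_mulVec (fockTranslate u).val B]
  -- both sides as `|𝕋|⁻¹ Σ_u Σ_i p_i ⟨·⟩`
  have hswap : ∀ χ : Fin m → Fock (Orb (FermionTorus 2 L)),
      ∑ i, (p i : ℂ) * torusAvgExpectAt L Λ A (χ i) =
        ((Fintype.card (TorusSite 2 L) : ℂ))⁻¹ * ∑ u : TorusSite 2 L, ∑ i,
          (p i : ℂ) * expect ((fockTranslate u).valᴴ * B * (fockTranslate u).val) (χ i) := by
    intro χ
    rw [Finset.sum_comm, Finset.mul_sum]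
    refine Finset.sum_congr rfl fun i _ => ?_
    rw [torusAvgExpectAt_of_injOn L hInj, Finset.mul_sum, Finset.mul_sum, Finset.mul_sum]
    refine Finset.sum_congr rfl fun u _ => ?_
    rw [h1, mul_left_comm]
  rw [Finset.sum_congr rfl fun i _ => by rw [havg], hswap (fun i => D' *ᵥ ψ i), hswap ψ]
  refine congrArg (fun z => ((Fintype.card (TorusSite 2 L) : ℂ))⁻¹ * z) (Finset.sum_congr rfl fun u _ => ?_)
  exact sum_canonicalWeight_spinSector_mul_expect_fockD4_mulVec_eq L t t' U β e hp hψ γ⁻¹ _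

end Torus

/-! ### §3 `D₄`-invariance of torus limits of spin-sector canonical states -/

namespace InfVolFermionState

/-- **Torus limits of spin-sector canonical states are point-group invariant.** Every torus limit `ω` along
`Ls → ∞` of the canonical Gibbs eigen-mixtures (any presentation `(m, p, ψ, e)`) of `hubbardTorusTT' L t t' U`
on the spin sectors `(a_L, b_L)` satisfies `ω ∘ γ = ω` for every `γ ∈ D₄` — in particular the companion
states of the two-sector rows. No nonemptiness or density hypothesis. [cite: Han2020Bootstrap, §3] -/
theorem IsTorusLimitOfMixture.isD4Invariant_of_spinSectorGibbs (t t' U β : ℝ) (a b : ℕ → ℕ)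
    {m : ℕ → ℕ} {p : ∀ L, Fin (m L) → ℝ} {ψ : ∀ L, Fin (m L) → Fock (Orb (FermionTorus 2 L))}
    (e : ∀ L, Fin (m L) ≃ Subtype (spinConfig (Λ := FermionTorus 2 L) (a L) (b L)))
    (hp : ∀ L i, p L i = canonicalWeight β (sectorEigenvalue (spinConfig (a L) (b L)) (hubbardTorusTT' L t t' U)
      (hubbardTorusTT'_isHermitian L t t' U)) (e L i))
    (hψ : ∀ L i, ψ L i = sectorEigenvector (spinConfig (a L) (b L)) (hubbardTorusTT' L t t' U)
      (hubbardTorusTT'_isHermitian L t t' U) (e L i))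
    {Ls : ℕ → ℕ} (hLs : Tendsto Ls atTop atTop) {ω : InfVolFermionState 2}
    (hω : ω.IsTorusLimitOfMixture m p ψ Ls) : ω.IsD4Invariant := by
  intro γ
  refine InfVolFermionState.ext fun Λ => LinearMap.ext fun A => ?_
  rw [d4Act_expect]
  refine tendsto_nhds_unique (hω (d4ShiftSet γ 0 Λ) (fermionEmbed (PolySite.d4Emb γ 0 Λ) A)) ((hω Λ A).congr' ?_)
  filter_upwards [eventually_injOn_proj_of_tendsto Λ hLs, eventually_injOn_proj_of_tendsto (d4ShiftSet γ 0 Λ) hLs,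
    hLs.eventually_ge_atTop 1] with j h1 h2 hj
  haveI : NeZero (Ls j) := ⟨by omega⟩
  simp_rw [torusAvgExpect_eq]
  exact (sum_canonicalWeight_spinSector_mul_torusAvgExpectAt_d4Emb (Ls j) t t' U β (e (Ls j)) (hp (Ls j))
    (hψ (Ls j)) γ h1 h2 A).symm

/-- **Torus limits of spin-sector canonical states kill every affine-`D₄` defect**:
`ω_{Λ'}(Γ(incl)(Γ(d4Emb γ w Λ) Y) − Γ(incl) Y) = 0` for all `γ ∈ D₄`, `w ∈ ℤ²`, `Λ ⊆ Λ'`, `γΛ + w ⊆ Λ'` — the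
point-group rows of the companion classes of the two-sector energy–entropy balance.
[cite: Han2020Bootstrap, §3] -/
theorem IsTorusLimitOfMixture.expect_d4Defect_eq_zero_of_spinSectorGibbs (t t' U β : ℝ) (a b : ℕ → ℕ)
    {m : ℕ → ℕ} {p : ∀ L, Fin (m L) → ℝ} {ψ : ∀ L, Fin (m L) → Fock (Orb (FermionTorus 2 L))}
    (e : ∀ L, Fin (m L) ≃ Subtype (spinConfig (Λ := FermionTorus 2 L) (a L) (b L)))
    (hp : ∀ L i, p L i = canonicalWeight β (sectorEigenvalue (spinConfig (a L) (b L)) (hubbardTorusTT' L t t' U)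
      (hubbardTorusTT'_isHermitian L t t' U)) (e L i))
    (hψ : ∀ L i, ψ L i = sectorEigenvector (spinConfig (a L) (b L)) (hubbardTorusTT' L t t' U)
      (hubbardTorusTT'_isHermitian L t t' U) (e L i))
    {Ls : ℕ → ℕ} (hLs : Tendsto Ls atTop atTop) {ω : InfVolFermionState 2}
    (hω : ω.IsTorusLimitOfMixture m p ψ Ls) {Λ Λ' : Finset (Site 2)} (hΛ : Λ ⊆ Λ')
    (γ : DihedralGroup 4) (w : Site 2) (hsh : d4ShiftSet γ w Λ ⊆ Λ') (Y : FermionOp Λ) :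
    ω.expect Λ' (fermionEmbed (PolySite.incl hsh) (fermionEmbed (PolySite.d4Emb γ w Λ) Y) -
      fermionEmbed (PolySite.incl hΛ) Y) = 0 :=
  hω.isTranslationInvariant.expect_d4Defect_eq_zero
    (hω.isD4Invariant_of_spinSectorGibbs t t' U β a b e hp hψ hLs) hΛ γ w hsh Y

/-- **By name for the standard presentation** (`Fintype.equivFin`, as in the two-sector companion
theorems): the companion states `ω'` of `…exists_twoSector_predCompanion_of_sectorGibbs` & co. are
`D₄`-invariant. [cite: Han2020Bootstrap, §3] -/
theorem IsTorusLimitOfMixture.isD4Invariant_of_spinSectorGibbs_equivFin (t t' U β : ℝ) (a b : ℕ → ℕ)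
    {Ls : ℕ → ℕ} (hLs : Tendsto Ls atTop atTop) {ω : InfVolFermionState 2}
    (hω : ω.IsTorusLimitOfMixture
      (fun L => Fintype.card (Subtype (spinConfig (Λ := FermionTorus 2 L) (a L) (b L))))
      (fun L i => canonicalWeight β (sectorEigenvalue (spinConfig (a L) (b L)) (hubbardTorusTT' L t t' U)
        (hubbardTorusTT'_isHermitian L t t' U)) ((Fintype.equivFin _).symm i))
      (fun L i => sectorEigenvector (spinConfig (a L) (b L)) (hubbardTorusTT' L t t' U)
        (hubbardTorusTT'_isHermitian L t t' U) ((Fintype.equivFin _).symm i)) Ls) :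
    ω.IsD4Invariant :=
  hω.isD4Invariant_of_spinSectorGibbs t t' U β a b (fun _ => (Fintype.equivFin _).symm) (fun _ _ => rfl)
    (fun _ _ => rfl) hLs

end InfVolFermionState

end Literature.MathematicalPhysics.QuantumLattice

end
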